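/-
Copyright (c) 2026 the pub-hodgecm-mathlib formalisation cell (harness21).  Prover seat hodgecm-mathlib-LH4-p15 (g2), req620 Track A «(D-RAM) FOUR-FRAME» squad
(STAGE-1b, row (2) of the piece `f_{T₊}`, the (β₂) road (R-36) «PURE-CELL LEDGER»; β₂ sub-dealer LH4-p04 (g10) WORD #24 letter ‹TERM.letter.v2› 78b8538f5e7a241e, holder LH4-p15 (g2)): the reads at the given generator,
2026-09-05.
-/
import Summits.HodgeConjecture.HodgeConjecture.Theorems.F0P3cDyRamTerminalVertexRead          -- ★ p864194 (this seat, T-b4): the three-way read of a terminal vertex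
import Summits.HodgeConjecture.HodgeConjecture.Theorems.F0P3cDyRamTerminalCellDigitFlip       -- ★ p864206 (this seat, T-b5a): `inv_cellScalar_mul_inv_trace_eq`
import Summits.HodgeConjecture.HodgeConjecture.Theorems.F0P3cDyRamUnitAffineDigitCount        -- ★ p863899 (this seat, T-c): `v_affine_eq_one_iff_of_near`
import Summits.HodgeConjecture.HodgeConjecture.Theorems.F0P3cDyRamAffineLabelDepthZero        -- ★ p864020 (this seat, T-b2a): `normSign_affine_eq_of_near`
import Summits.HodgeConjecture.HodgeConjecture.Theorems.F0P3cDyRamRowCellSocketReads          -- ★ p863914 (LH4-p16 (g2)): the (hL) sign constant; brings ★ `normSign_mul_eq_one_iff_eq`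
import Summits.HodgeConjecture.HodgeConjecture.Theorems.F0P3cDyRamRowCleanCellBit             -- ★ (LH4-p06 (g9)): brings ★ p862869 `exists_presentation_of_mem_levelSetDep`, ‹OFF› vocabulary
import HarnessLib

/-!
# Crux `H413`, line LH4 «(D-RAM) FOUR-FRAME» — STAGE-1b, row (2), the (β₂) road (R-36), (ROW-TERM): «THE THREE READS AT THE GIVEN GENERATOR» — for a populated member
# `(Λ, x₀)` of the terminal cell, its coordinate `V_e` and any glued vertex `L₃`: level `0`; `¬`level `1` ⟺ `|α₁ + γ₁V_e| = 1`; and then `VS_(m*)(Γ − 1 | L₃) = X₊ ⟺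
# ω(α₁ + γ₁V_e) = ω(−h_W)` (part of the proof of ‹TERM.letter.v2›, ★ `…F0P3cDyRamTermHolds.term_holds`, split out per declaration)

Cell `hodgecm-mathlib` (D-0151), FLOOR 0, crux item H413 = `stmt-HodgeConjecture-24833`, route of record `HCCMUnconditional`; squad F0∕P3c∕LH4; lane
`--supports stmt-HodgeConjecture-24833 --as helper` (count-neutral; pays NO tier-0 row).  THEOREMS ONLY (no `def`, no instance, no notation, no `sorry`, default heartbeats);
★-only imports; states NO law; (β₂) stays a HYPOTHESIS.  ★ p864194 at ★ p862869's presentation of the glued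
vertex (the pairing literal `⟨w₀, w₀⟩` generalised before the rewrites), LH4-p16 (g2)'s ★ p863914 §3 sign constant `ω(pw·P) = ω(−h_W)` on the populated member, ★ (T-b5a) §1
(the vertex coordinate is the generator digit), the digit moved to the given generator by (hI), the class functions of ★ p863899 §1 ∕ ★ p864020.
* HEAD `reads_of_gen`.
HONEST LABEL.  Count-neutral; nothing printed is asserted; no census law is stated; `HC_CM` is proved only modulo the 7 printed citations (2 remaining named inputs: hLiu418 =
`stmt-HodgeConjecture-24832`, h413 = `stmt-HodgeConjecture-24833`) until rung 0 closes.
## References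
* [Kottwitz1986BaseChangeUnits] R. E. Kottwitz, *Base change for unit elements of Hecke algebras*, Compositio Math. 60 (1986): §1 pp. 240–241, §3.
* [Rogawski1990] J. D. Rogawski, *Automorphic Representations of Unitary Groups in Three Variables*, Ann. of Math. Stud. 123 (1990): §4.9 Prop. 4.9.1 (b) p. 55.
* [Jacobowitz1962] R. Jacobowitz, *Hermitian forms over local fields*, Amer. J. Math. 84 (1962): §4.
* [Serre1979] J.-P. Serre, *Local Fields*, GTM 67 (1979): Ch. III §6 Prop. 12; Ch. V §3 Cor. 3 pp. 84–86; Ch. XV §2.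
* [Flicker1998UnitaryFL] Y. Z. Flicker, *Elementary proof of the fundamental lemma for a unitary group*, Canad. J. Math. 50 (1998): Prop. 7 p. 84.
-/

set_option autoImplicit false

noncomputable section

namespace Summit.HodgeConjecture.HodgeConjecture.Cruxes.H413.F0P3cDyRamTerminalCellReads

open scoped Matrix MatrixGroups Classical Valued WithZero
open WithZero
open Literature.NumberTheory.Automorphic Literature.NumberTheory.Automorphic.UnitaryThreeFourFrame Literature.NumberTheory.Automorphic.UnitaryLatticeTree
open Literature.NumberTheory.Automorphic.HermitianLattice Literature.NumberTheory.Automorphic.EllipticPlaneAsFieldLine Literature.NumberTheory.LocalFields.QuadraticOrder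
open Literature.NumberTheory.Rogawski1990
open Summit.HodgeConjecture.HodgeConjecture.Cruxes.H413.F0P3cDyRamToricCensusDefs Summit.HodgeConjecture.HodgeConjecture.Cruxes.H413.F0P3cDyRamFourFramePieces
open Summit.HodgeConjecture.HodgeConjecture.Cruxes.H413.F0P3cDyRamFourFrameCensusDefs Summit.HodgeConjecture.HodgeConjecture.Cruxes.H413.F0P3cDyRamStageOneBDefs
open Summit.HodgeConjecture.HodgeConjecture.Cruxes.H413
open Summit.HodgeConjecture.HodgeConjecture.Cruxes.H413.F0P3cDyRamConeCellPresentation (exists_presentation_of_mem_levelSetDep)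
open Summit.HodgeConjecture.HodgeConjecture.Cruxes.H413.F0P3cDyRamDiagonalCellLetter (inv_add_map_inv_eq_map_pairing)
open Summit.HodgeConjecture.HodgeConjecture.Cruxes.H413.F0P3cDyRamRowVertexAffineCoordinate (map_cellScalar_theta exists_coord_of_vertex)
open Summit.HodgeConjecture.HodgeConjecture.Cruxes.H413.F0P3cDyRamRowCellFibreTransport (trace_letters)
open Summit.HodgeConjecture.HodgeConjecture.Cruxes.H413.F0P3cDyRamRowCellSocketReads (weight_ne_zero_iff_normSign_pairing_of_gen)
open Summit.HodgeConjecture.HodgeConjecture.Cruxes.H413.F0P3cDyRamRowVertexPopulationRead (normSign_mul_eq_one_iff_eq)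
open Summit.HodgeConjecture.HodgeConjecture.Cruxes.H413.F0P3cDyRamUnitAffineDigitCount (v_affine_eq_one_iff_of_near)
open Summit.HodgeConjecture.HodgeConjecture.Cruxes.H413.F0P3cDyRamAffineLabelDepthZero (normSign_affine_eq_of_near)
open Summit.HodgeConjecture.HodgeConjecture.Cruxes.H413.F0P3cDyRamTerminalVertexRead (level_and_label_of_terminalVertex)
open Summit.HodgeConjecture.HodgeConjecture.Cruxes.H413.F0P3cDyRamTerminalCellDigitFlip (inv_cellScalar_mul_inv_trace_eq)


/-- **THE THREE READS AT THE GIVEN GENERATOR** — for a populated member `(Λ, x₀)` of the terminal cell, its coordinate `V_e` and any glued vertex `L₃`: level `0`; `¬`level `1` ⟺ `|α₁ + γ₁V_e| = 1`; and then `VS_{m*}(Γ − 1 | L₃) = X₊ ⟺ ω(α₁ + γ₁V_e) = ω(−h_W)` (★ p864194 at ★ p862869's presentation, ★ p863914 §3's sign constant, the digit moved by (hI)). [cite: Kottwitz1986BaseChangeUnits, §1 pp. 240–241; §3] [cite: Rogawski1990, §4.9 Prop. 4.9.1 (b) p. 55] [cite: Jacobowitz1962, §4] -/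
theorem reads_of_gen
    {E M : Type} [Field E] [Valued E ℤᵐ⁰] [CompleteSpace E] [IsDiscreteValuationRing 𝒪[E]] [Finite 𝓀[E]]
    [Field M] [Valued M ℤᵐ⁰] [CompleteSpace M] [IsDiscreteValuationRing 𝒪[M]] [Finite 𝓀[M]]
    {σ : E →+* E} {ϖ : E} {tE : ℕ} {jE : E →+* M} {ρ : M →+* M} {Θ : M →+* M} {α : M} {lam : M} {γ₂ : GL (Fin 2) E} {u : GL (Fin 1) E} {H₂ : Matrix (Fin 2) (Fin 2) E} {hW : E} {φ : (Fin 2 → E) →+ M} {h : M} {f : ℕ → ℕ → AddSubgroup M → ℕ} {b : ℕ} {j : ℕ} {κ₀ : M} {ξ₀ : M} {R₀ : E} {γ₀ : E} {μa : E} {μb : E} {α₁ : E} {γ₁ : E}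
    (hbj : b < j)
    (hD : IsRamifiedQuadraticDatum σ ϖ 2 tE)
    (hσσ : ∀ a, σ (σ a) = a)
    (hvσ : ∀ a, Valued.v (σ a) = Valued.v a)
    (hϖ : Valued.v ϖ = exp (-1 : ℤ))
    (h2v : Valued.v (2 : E) < 1)
    (hH₂ : IsUnit H₂.det)
    (hH₂σ : (H₂.map σ)ᵀ = H₂)
    (hhW : Valued.v hW = 1)
    (hhWσ : σ hW = hW)
    (hhW1 : Valued.v (jE hW) = 1)
    (hjv : ∀ a, Valued.v (jE a) ≤ 1 ↔ Valued.v a ≤ 1)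
    (hjiso : ∀ a, Valued.v (jE a) = Valued.v a)
    (hjfix : ∀ z : M, ρ z = z ↔ ∃ a, jE a = z)
    (hΘj : ∀ a, Θ (jE a) = jE (σ a))
    (hρρ : ∀ z, ρ (ρ z) = z)
    (hvρ : ∀ z, Valued.v (ρ z) = Valued.v z)
    (hα : ρ α ≠ α)
    (hα1 : Valued.v α ≤ 1)
    (hint : ∀ z : M, Valued.v z ≤ 1 → Valued.v ((z - ρ z) / (α - ρ α)) ≤ 1)
    (hΘΘ : ∀ z, Θ (Θ z) = z)
    (hΘρ : ∀ z, Θ (ρ z) = ρ (Θ z))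
    (hvΘ : ∀ z, Valued.v (Θ z) = Valued.v z)
    (hjpow : ∀ (t : E) (n : ℤ), Valued.v (jE t) = Valued.v (jE ϖ) ^ n ↔ Valued.v t = Valued.v ϖ ^ n)
    (hϖmax : ∀ t : M, ρ t = t → Valued.v t < 1 → Valued.v t ≤ Valued.v (jE ϖ))
    (hφs : ∀ (c : E) (x : Fin 2 → E), φ (c • x) = jE c * φ x)
    (hφi : Function.Injective φ)
    (hφo : Function.Surjective φ)
    (hφγ : ∀ x, φ ((γ₂ : Matrix (Fin 2) (Fin 2) E).mulVec x) = lam * φ x)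
    (hvlam : Valued.v lam = 1)
    (hΘlam : Θ lam * lam = 1)
    (hΘh : Θ h = h)
    (hh : h ≠ 0)
    (hform : ∀ x y, jE (pairing σ H₂ x y) = h * Θ (φ x) * φ y + ρ (h * Θ (φ x) * φ y))
    (huu : ((u : Matrix (Fin 1) (Fin 1) E) 0 0) * σ ((u : Matrix (Fin 1) (Fin 1) E) 0 0) = 1)
    (hU : Valued.v (α - ρ α) = 1)
    (hb : 1 ≤ b)
    (hdb : 2 ≤ b)
    (hlamj : IsOrd ρ α (jE ϖ ^ j) lam)
    (hf : ∀ (b j : ℕ) (Λ : AddSubgroup M) (x₀ : M) (r : E), 1 ≤ b → x₀ ≠ 0 → (∀ x, x ∈ Λ ↔ ∃ z, IsOrd ρ α (jE ϖ ^ j) z ∧ x = x₀ * z) →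
      IsOrd ρ α (jE ϖ ^ j) (dualGen ρ Θ α (jE ϖ ^ j) h x₀) → ¬ IsOrd ρ α (jE ϖ ^ j) (dualGen ρ Θ α (jE ϖ ^ j) h x₀ / jE ϖ) → Valued.v (dualGen ρ Θ α (jE ϖ ^ j) h x₀) = Valued.v (jE ϖ) ^ b →
      (∀ b', (∀ x ∈ Λ, Valued.v (h * Θ x * b' + ρ (h * Θ x * b')) ≤ 1) → (lam - jE ((u : Matrix (Fin 1) (Fin 1) E) 0 0)) * b' ∈ Λ) → IsOrd ρ α (jE ϖ ^ j) lam →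
      jE r = glueUnit ρ Θ α (jE ϖ ^ j) h (jE ϖ) (jE hW) x₀ b →
      f b j Λ = Nat.card {x : 𝒪[E] ⧸ 𝓂[E] ^ (2 * b) // ∃ u' : 𝒪[E], Ideal.Quotient.mk (𝓂[E] ^ (2 * b)) u' = x ∧ Valued.v ((u' : E) * σ u' - r) ≤ Valued.v (ϖ ^ (2 * b))})
    (hcell : levelSetDep ρ Θ α (jE ϖ) h j b (lam - jE ((u : Matrix (Fin 1) (Fin 1) E) 0 0)) = levelSet ρ Θ α (jE ϖ) h j b)
    (hϖlt : Valued.v ϖ < 1)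
    (hjϖ0 : jE ϖ ≠ 0)
    (hvjϖ0 : Valued.v (jE ϖ) ≠ 0)
    (hjϖle : Valued.v (jE ϖ) ≤ 1)
    (hρϖ : ρ (jE ϖ) = jE ϖ)
    (hc : ρ (jE ϖ ^ j) = jE ϖ ^ j)
    (hc1 : Valued.v (jE ϖ ^ j) ≤ 1)
    (hcc : jE ϖ ^ j * (α - ρ α) ≠ 0)
    (hccv : Valued.v (jE ϖ ^ j * (α - ρ α)) = Valued.v (jE ϖ) ^ j)
    (hFgap : ∀ z : M, ρ z = z → Θ z = z → Valued.v (jE ϖ) < Valued.v z → Valued.v z ≤ 1 → Valued.v z = 1)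
    (hms : mstarOfRecord 2 = 3)
    (hd0 : (2 : ℕ) % 2 = 0)
    (hμv : Valued.v (lam - jE ((u : Matrix (Fin 1) (Fin 1) E) 0 0)) = Valued.v (jE ϖ) ^ (2 * b))
    (hμρv : Valued.v ((lam - jE ((u : Matrix (Fin 1) (Fin 1) E) 0 0)) - ρ (lam - jE ((u : Matrix (Fin 1) (Fin 1) E) 0 0))) = Valued.v (jE ϖ) ^ (j + b))
    (hlamρ : lam - ρ lam = (lam - jE ((u : Matrix (Fin 1) (Fin 1) E) 0 0)) - ρ (lam - jE ((u : Matrix (Fin 1) (Fin 1) E) 0 0)))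
    (hlam4 : Valued.v (lam - 1) ≤ Valued.v (jE ϖ) ^ 4)
    (hu4 : Valued.v (((u : Matrix (Fin 1) (Fin 1) E) 0 0) - 1) ≤ Valued.v ϖ ^ 4)
    (hu1 : Valued.v (((u : Matrix (Fin 1) (Fin 1) E) 0 0) - 1) ≤ Valued.v ϖ)
    (hule : Valued.v ((u : Matrix (Fin 1) (Fin 1) E) 0 0) ≤ 1)
    (hΘα : Valued.v (Θ α - α) ≤ Valued.v (jE ϖ))
    (h42 : Valued.v ϖ ^ 4 ≤ Valued.v ϖ ^ 2)
    (hκ₀ : κ₀ + ρ κ₀ = 1)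
    (hΘκ₀ : Θ κ₀ = κ₀)
    (hξ : ρ ξ₀ = -ξ₀)
    (hΘξ : Θ ξ₀ = ξ₀)
    (hξ0 : ξ₀ ≠ 0)
    (hR₀ : jE R₀ = α * κ₀ + ρ (α * κ₀))
    (hγ₀ : jE γ₀ = ξ₀ * (α - ρ α))
    (hμab : (lam - jE ((u : Matrix (Fin 1) (Fin 1) E) 0 0)) = jE μa + jE μb * α)
    (hâ : Valued.v (μa + μb * R₀) ≤ Valued.v ϖ ^ (2 * b))
    (hbh : Valued.v (μb * γ₀) = Valued.v ϖ ^ (2 * b))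
    (hσα₁ : σ α₁ = α₁)
    (hσγ₁ : σ γ₁ = γ₁)
    (hγ₁ : Valued.v γ₁ = 1)
    (hnx : ∀ W : E, σ W = W → Valued.v W ≤ 1 →
      (Valued.v ((μa + μb * R₀) * ((ϖ * σ ϖ) ^ b)⁻¹ + μb * γ₀ * ((ϖ * σ ϖ) ^ b)⁻¹ * W) = 1 ↔ Valued.v (α₁ + γ₁ * W) = 1))
    (haff : ∀ (T W f : E), σ T = T → Valued.v T = 1 → σ W = W → Valued.v W ≤ 1 → σ f = f → Valued.v (α₁ + γ₁ * W) = 1 →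
      Valued.v (T * ((μa + μb * R₀) * ((ϖ * σ ϖ) ^ b)⁻¹ + μb * γ₀ * ((ϖ * σ ϖ) ^ b)⁻¹ * W) - f * ((ϖ - σ ϖ) * ((ϖ * σ ϖ) ^ ((2 - 2 % 2) / 2))⁻¹)) ≤
        Valued.v ϖ ^ mstarOfRecord 2 → normSign σ f = normSign σ T * normSign σ (α₁ + γ₁ * W))
    (hV : ∀ (Λ : AddSubgroup M) (x₀ : M), (x₀ ≠ 0 ∧ (∀ x, x ∈ Λ ↔ ∃ ζ, IsOrd ρ α (jE ϖ ^ j) ζ ∧ x = x₀ * ζ) ∧ IsOrd ρ α (jE ϖ ^ j) (dualGen ρ Θ α (jE ϖ ^ j) h x₀) ∧ ¬ IsOrd ρ α (jE ϖ ^ j) (dualGen ρ Θ α (jE ϖ ^ j) h x₀ / jE ϖ) ∧ Valued.v (dualGen ρ Θ α (jE ϖ ^ j) h x₀) = Valued.v (jE ϖ) ^ b) →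
      ∃ Ve : E, jE Ve = (((ρ (h * (x₀ * Θ x₀)) / ((h * (x₀ * Θ x₀)) + ρ (h * (x₀ * Θ x₀)))) - κ₀) / ξ₀) ∧ σ Ve = Ve ∧ Valued.v Ve ≤ 1)
    (hdepG : ∀ (Λ : AddSubgroup M) (x₀ : M), (x₀ ≠ 0 ∧ (∀ x, x ∈ Λ ↔ ∃ ζ, IsOrd ρ α (jE ϖ ^ j) ζ ∧ x = x₀ * ζ) ∧ IsOrd ρ α (jE ϖ ^ j) (dualGen ρ Θ α (jE ϖ ^ j) h x₀) ∧ ¬ IsOrd ρ α (jE ϖ ^ j) (dualGen ρ Θ α (jE ϖ ^ j) h x₀ / jE ϖ) ∧ Valued.v (dualGen ρ Θ α (jE ϖ ^ j) h x₀) = Valued.v (jE ϖ) ^ b) →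
      Λ ∈ levelSetDep ρ Θ α (jE ϖ) h j b (lam - jE ((u : Matrix (Fin 1) (Fin 1) E) 0 0)) ∧ IsOrd ρ α (jE ϖ ^ j) ((lam - jE ((u : Matrix (Fin 1) (Fin 1) E) 0 0)) / dualGen ρ Θ α (jE ϖ ^ j) h x₀))
    (hI : ∀ (Λ : AddSubgroup M) (x₀ x₀' : M), (x₀ ≠ 0 ∧ (∀ x, x ∈ Λ ↔ ∃ ζ, IsOrd ρ α (jE ϖ ^ j) ζ ∧ x = x₀ * ζ) ∧ IsOrd ρ α (jE ϖ ^ j) (dualGen ρ Θ α (jE ϖ ^ j) h x₀) ∧ ¬ IsOrd ρ α (jE ϖ ^ j) (dualGen ρ Θ α (jE ϖ ^ j) h x₀ / jE ϖ) ∧ Valued.v (dualGen ρ Θ α (jE ϖ ^ j) h x₀) = Valued.v (jE ϖ) ^ b) → (x₀' ≠ 0 ∧ (∀ x, x ∈ Λ ↔ ∃ ζ, IsOrd ρ α (jE ϖ ^ j) ζ ∧ x = x₀' * ζ) ∧ IsOrd ρ α (jE ϖ ^ j) (dualGen ρ Θ α (jE ϖ ^ j) h x₀') ∧ ¬ IsOrd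 ρ α (jE ϖ ^ j) (dualGen ρ Θ α (jE ϖ ^ j) h x₀' / jE ϖ) ∧ Valued.v (dualGen ρ Θ α (jE ϖ ^ j) h x₀') = Valued.v (jE ϖ) ^ b) →
      (((∃ e : M, ρ e = e ∧ e * Θ e = (h * (x₀ * Θ x₀)) + ρ (h * (x₀ * Θ x₀)))) ↔ ((∃ e : M, ρ e = e ∧ e * Θ e = (h * (x₀' * Θ x₀')) + ρ (h * (x₀' * Θ x₀'))))) ∧ Valued.v ((((ρ (h * (x₀' * Θ x₀')) / ((h * (x₀' * Θ x₀')) + ρ (h * (x₀' * Θ x₀')))) - κ₀) / ξ₀) - (((ρ (h * (x₀ * Θ x₀)) / ((h * (x₀ * Θ x₀)) + ρ (h * (x₀ * Θ x₀)))) - κ₀) / ξ₀)) ≤ Valued.v ϖ ^ (2 * 2)) :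
    ∀ (Λ : AddSubgroup M) (x₀ : M), (x₀ ≠ 0 ∧ (∀ x, x ∈ Λ ↔ ∃ ζ, IsOrd ρ α (jE ϖ ^ j) ζ ∧ x = x₀ * ζ) ∧ IsOrd ρ α (jE ϖ ^ j) (dualGen ρ Θ α (jE ϖ ^ j) h x₀) ∧ ¬ IsOrd ρ α (jE ϖ ^ j) (dualGen ρ Θ α (jE ϖ ^ j) h x₀ / jE ϖ) ∧ Valued.v (dualGen ρ Θ α (jE ϖ ^ j) h x₀) = Valued.v (jE ϖ) ^ b) → f b j Λ ≠ 0 → ∀ Ve : E, jE Ve = (((ρ (h * (x₀ * Θ x₀)) / ((h * (x₀ * Θ x₀)) + ρ (h * (x₀ * Θ x₀)))) - κ₀) / ξ₀) →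
      ∀ (B : Submodule 𝒪[E] (Fin 2 → E)) (L₃ : Submodule 𝒪[E] (Fin 3 → E)), B.toAddSubgroup.map φ = Λ →
      IsSelfDualLattice σ ϖ (!![H₂ 0 0, 0, H₂ 0 1; 0, hW, 0; H₂ 1 0, 0, H₂ 1 1] : Matrix (Fin 3) (Fin 3) E) L₃ →
      L₃ ⊓ LinearMap.ker ((LinearMap.proj (1 : Fin 3) : (Fin 3 → E) →ₗ[E] E).restrictScalars 𝒪[E]) =
        B.map ((Matrix.toLin' (!![1, 0; 0, 0; 0, 1] : Matrix (Fin 3) (Fin 2) E)).restrictScalars 𝒪[E]) →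
      (∀ c : E, (Pi.single 1 c : Fin 3 → E) ∈ L₃ ↔ Valued.v c ≤ Valued.v ϖ ^ b) →
      LatticeInLevel ϖ 0 ((((endoGL (γ₂, u) : GL (Fin 3) E) : Matrix (Fin 3) (Fin 3) E) - 1)) L₃ ∧ (¬ LatticeInLevel ϖ 1 ((((endoGL (γ₂, u) : GL (Fin 3) E) : Matrix (Fin 3) (Fin 3) E) - 1)) L₃ ↔ (Valued.v (α₁ + γ₁ * Ve) = 1)) ∧
        ((Valued.v (α₁ + γ₁ * Ve) = 1) → ({z : E | ∃ y ∈ L₃, Valued.v ((ϖ ^ (mstarOfRecord 2))⁻¹ * (z - pairing σ (!![H₂ 0 0, 0, H₂ 0 1; 0, hW, 0; H₂ 1 0, 0, H₂ 1 1] : Matrix (Fin 3) (Fin 3) E) y (((((endoGL (γ₂, u) : GL (Fin 3) E) : Matrix (Fin 3) (Fin 3) E) - 1)) *ᵥ y))) ≤ 1} = valueSetMod σ ϖ (mstarOfRecord 2) (xPlus σ ϖ 2) ↔ normSign σ (α₁ + γ₁ * Ve) = normSign σ (-hW))) := by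
  intro Λ x₀ hG hfne Ve hVe B L₃ hBΛ hL hLB htube
  have hΛ := (hdepG Λ x₀ hG).1
  obtain ⟨Ve', hVe', hσVe, hVe1⟩ := hV Λ x₀ hG
  obtain rfl : Ve = Ve' := jE.injective (hVe.trans hVe'.symm)
  -- the presentation of the vertex and its letters
  obtain ⟨x₁, w₀, g₀, hx₁, hΛx₁, hyO₁, hyp₁, hylev₁, hw₀Y, hpr, hg₀, hg₀1, hprg⟩ :=
    exists_presentation_of_mem_levelSetDep σ hσσ hvσ hϖ hH₂ hH₂σ hhW jE hρρ hvρ hα hα1 hint hΘΘ hΘρ hvΘ hjv hjfix hjpow hϖmax φ hφs hφi hφo hφγ hvlam hΘh hh hform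
      ((u : Matrix (Fin 1) (Fin 1) E) 0 0) hb hlamj hΛ hBΛ hL hLB htube
  have hG₁ : (x₁ ≠ 0 ∧ (∀ x, x ∈ Λ ↔ ∃ ζ, IsOrd ρ α (jE ϖ ^ j) ζ ∧ x = x₁ * ζ) ∧ IsOrd ρ α (jE ϖ ^ j) (dualGen ρ Θ α (jE ϖ ^ j) h x₁) ∧ ¬ IsOrd ρ α (jE ϖ ^ j) (dualGen ρ Θ α (jE ϖ ^ j) h x₁ / jE ϖ) ∧ Valued.v (dualGen ρ Θ α (jE ϖ ^ j) h x₁) = Valued.v (jE ϖ) ^ b) := ⟨hx₁, hΛx₁, hyO₁, hyp₁, hylev₁⟩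
  have hdep₁ := (hdepG Λ x₁ hG₁).2
  obtain ⟨hρt₁, hΘt₁, ht₁⟩ := trace_letters (α := α) hρρ hΘΘ hΘρ hΘh hρϖ hjϖ0 hjϖle hb hcc hFgap hyO₁ hyp₁ hylev₁
  have ht₁0 : (h * (x₁ * Θ x₁)) + ρ (h * (x₁ * Θ x₁)) ≠ 0 := fun h0 => by rw [h0, map_zero] at ht₁; exact zero_ne_one ht₁
  have hu₁0 : (h * (x₁ * Θ x₁)) ≠ 0 := mul_ne_zero hh (mul_ne_zero hx₁ ((map_ne_zero Θ).2 hx₁))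
  have hκh0 : (ρ (h * (x₁ * Θ x₁)) / ((h * (x₁ * Θ x₁)) + ρ (h * (x₁ * Θ x₁)))) ≠ 0 := div_ne_zero ((map_ne_zero ρ).2 hu₁0) ht₁0
  -- the glue letter, `pw` (generalised: the pairing literal is kept out of the rewrites), the coordinate `V₁`
  have hTr' := inv_add_map_inv_eq_map_pairing σ H₂ jE hΘΘ φ hh hform hcc hx₁ hw₀Y
  obtain ⟨pw, hpwdef⟩ : ∃ pw : E, pw = pairing σ H₂ w₀ w₀ := ⟨_, rfl⟩
  have hTr : (jE ϖ ^ j * (α - ρ α) * Θ (dualGen ρ Θ α (jE ϖ ^ j) h x₁))⁻¹ + ρ (jE ϖ ^ j * (α - ρ α) * Θ (dualGen ρ Θ α (jE ϖ ^ j) h x₁))⁻¹ = jE pw := by rw [hpwdef]; exact hTr'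
  have hΘD := map_cellScalar_theta (ρ := ρ) (α := α) hΘΘ hΘh (jE ϖ ^ j) x₁
  have hκh₁ := inv_cellScalar_mul_inv_trace_eq (α := α) hρρ hΘΘ hΘρ hc hΘh hcc hx₁ hh ht₁0 hTr
  have hpw0 : pw ≠ 0 := fun h0 => by
    have hj0 : jE pw = 0 := by rw [h0, map_zero]
    rw [hj0, inv_zero, mul_zero] at hκh₁; exact hκh0 hκh₁.symm
  have hΘpw : Θ (jE pw) = jE pw := by rw [← hTr, map_add Θ, hΘρ, map_inv₀ Θ, hΘD]
  have hσpw : σ pw = pw := jE.injective (by rw [← hΘj]; exact hΘpw)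
  obtain ⟨V₁, hσV₁, hκ⟩ := exists_coord_of_vertex jE hjfix hΘj hTr hpw0 hσpw hΘD hκ₀ hξ hξ0 hΘκ₀ hΘξ
  have hV₁f : jE V₁ = ((((ρ (h * (x₁ * Θ x₁)) / ((h * (x₁ * Θ x₁)) + ρ (h * (x₁ * Θ x₁))))) - κ₀) / ξ₀) := by
    have e := hκ.symm.trans hκh₁
    rw [eq_div_iff hξ0]; linear_combination e
  obtain ⟨Ve₁, hVe₁, -, hVe₁1⟩ := hV Λ x₁ hG₁
  have hV₁1 : Valued.v V₁ ≤ 1 := by rw [jE.injective (hV₁f.trans hVe₁.symm)]; exact hVe₁1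
  -- `|pw·P| = 1`
  have hD₀0 : (jE ϖ ^ j * (α - ρ α) * Θ (dualGen ρ Θ α (jE ϖ ^ j) h x₁)) ≠ 0 := by
    refine mul_ne_zero hcc ((map_ne_zero Θ).2 ?_)
    rw [dualGen_def]; exact mul_ne_zero hu₁0 hcc
  have hpwv : Valued.v (pw * (ϖ * σ ϖ) ^ b) = 1 := by
    have hjpw0 : jE pw ≠ 0 := (map_ne_zero jE).2 hpw0
    have e1 : (jE pw)⁻¹ = (jE ϖ ^ j * (α - ρ α) * Θ (dualGen ρ Θ α (jE ϖ ^ j) h x₁)) * (ρ (h * (x₁ * Θ x₁)) / ((h * (x₁ * Θ x₁)) + ρ (h * (x₁ * Θ x₁)))) := by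
      rw [← hκh₁, ← mul_assoc, mul_inv_cancel₀ hD₀0, one_mul]
    have hYu : dualGen ρ Θ α (jE ϖ ^ j) h x₁ = (h * (x₁ * Θ x₁)) * (jE ϖ ^ j * (α - ρ α)) := by rw [dualGen_def]
    have hYv' : Valued.v (jE ϖ ^ j * (α - ρ α)) * Valued.v (h * (x₁ * Θ x₁)) = Valued.v (jE ϖ) ^ b := by
      rw [mul_comm, ← Valuation.map_mul, ← hYu, hylev₁]
    have hprod : Valued.v (jE ϖ ^ j * (α - ρ α) * Θ (dualGen ρ Θ α (jE ϖ ^ j) h x₁)) * Valued.v (ρ (h * (x₁ * Θ x₁)) / ((h * (x₁ * Θ x₁)) + ρ (h * (x₁ * Θ x₁)))) = Valued.v (jE ϖ) ^ (2 * b) := by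
      rw [Valuation.map_mul _ (jE ϖ ^ j * (α - ρ α)), hvΘ, hylev₁, map_div₀, hvρ, ht₁, div_one, mul_right_comm, hYv', ← pow_add, two_mul]
    have hjpw : Valued.v (jE pw) * Valued.v (jE ϖ) ^ (2 * b) = 1 := by
      have h1 := congrArg Valued.v e1
      rw [map_inv₀, Valuation.map_mul, hprod] at h1
      rw [← h1, mul_inv_cancel₀ ((Valuation.ne_zero_iff _).2 hjpw0)]
    rw [← hjiso, map_mul jE pw ((ϖ * σ ϖ) ^ b), Valuation.map_mul _ (jE pw), map_pow jE (ϖ * σ ϖ) b,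
      map_mul jE ϖ (σ ϖ), Valuation.map_pow, Valuation.map_mul _ (jE ϖ) (jE (σ ϖ)), ← hΘj, hvΘ, ← pow_two, ← pow_mul]
    exact hjpw
  -- back to the pairing literal for ★ p864194 and ★ p863914 §3
  have hσpw' : σ (pairing σ H₂ w₀ w₀) = pairing σ H₂ w₀ w₀ := by rw [← hpwdef]; exact hσpw
  have hpwv' : Valued.v (pairing σ H₂ w₀ w₀ * (ϖ * σ ϖ) ^ b) = 1 := by rw [← hpwdef]; exact hpwv
  have hκ' : (jE ϖ ^ j * (α - ρ α) * Θ (dualGen ρ Θ α (jE ϖ ^ j) h x₁))⁻¹ * (jE (pairing σ H₂ w₀ w₀))⁻¹ = κ₀ + jE V₁ * ξ₀ := by rw [← hpwdef]; exact hκ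
  -- sizes at the presentation
  have hintL : ∀ y ∈ L₃, Valued.v (pairing σ (!![H₂ 0 0, 0, H₂ 0 1; 0, hW, 0; H₂ 1 0, 0, H₂ 1 1] : Matrix (Fin 3) (Fin 3) E) y y) ≤ 1 :=
    fun y hy => (mem_dualLatt σ _ L₃ y).1 (le_dualLatt_of_isVertexLattice hvσ hL hy) y hy
  have hb3 : Valued.v (jE ϖ) ^ (2 * b) * Valued.v (jE ϖ) ≤ Valued.v (α - ρ α) * Valued.v (jE ϖ) ^ b * Valued.v (jE ϖ) ^ mstarOfRecord 2 := by
    rw [hU, one_mul, hms, ← pow_succ, ← pow_add]; exact pow_le_pow_right_of_le_one' hjϖle (by omega)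
  have g1 : Valued.v (lam - jE ((u : Matrix (Fin 1) (Fin 1) E) 0 0)) * Valued.v (jE ϖ) ^ (2 - 1) ≤ Valued.v (α - ρ α) * Valued.v (jE ϖ) ^ b * Valued.v (jE ϖ) ^ mstarOfRecord 2 := by
    rw [hμv, show (2 - 1 : ℕ) = 1 from rfl, pow_one]; exact hb3
  have g2 : Valued.v (lam - jE ((u : Matrix (Fin 1) (Fin 1) E) 0 0)) * Valued.v (Θ α - α) ≤ Valued.v (α - ρ α) * Valued.v (jE ϖ) ^ b * Valued.v (jE ϖ) ^ mstarOfRecord 2 := by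
    rw [hμv]; exact (mul_le_mul' le_rfl hΘα).trans hb3
  have g3 : Valued.v (lam - jE ((u : Matrix (Fin 1) (Fin 1) E) 0 0)) * Valued.v (jE ϖ ^ j) ≤ Valued.v (α - ρ α) * Valued.v (jE ϖ) ^ b * Valued.v (jE ϖ) ^ mstarOfRecord 2 := by
    rw [hμv, hU, one_mul, hms, Valuation.map_pow, ← pow_add, ← pow_add]; exact pow_le_pow_right_of_le_one' hjϖle (by omega)
  have hμ1 : Valued.v (lam - jE ((u : Matrix (Fin 1) (Fin 1) E) 0 0)) ≤ Valued.v (jE ϖ) := by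
    rw [hμv]; exact (pow_le_pow_right_of_le_one' hjϖle (by omega : 1 ≤ 2 * b)).trans (le_of_eq (pow_one _))
  have hanti1 : Valued.v ((lam - jE ((u : Matrix (Fin 1) (Fin 1) E) 0 0)) - ρ (lam - jE ((u : Matrix (Fin 1) (Fin 1) E) 0 0))) ≤ Valued.v (jE ϖ ^ j * (α - ρ α)) * Valued.v (jE ϖ) := by
    rw [hμρv, hccv, ← pow_succ]; exact pow_le_pow_right_of_le_one' hjϖle (by omega)
  have hμY1 : Valued.v ((lam - jE ((u : Matrix (Fin 1) (Fin 1) E) 0 0)) / dualGen ρ Θ α (jE ϖ ^ j) h x₁) ≤ Valued.v (jE ϖ) := by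
    rw [map_div₀, hμv, hylev₁, two_mul, pow_add, mul_div_cancel_right₀ _ (pow_ne_zero _ hvjϖ0)]
    exact (pow_le_pow_right_of_le_one' hjϖle hb).trans (le_of_eq (pow_one _))
  have hsk : Valued.v ((lam - jE ((u : Matrix (Fin 1) (Fin 1) E) 0 0)) / dualGen ρ Θ α (jE ϖ ^ j) h x₁) * Valued.v (lam - ρ lam) ≤ Valued.v (jE ϖ) ^ 4 * Valued.v (jE ϖ ^ j * (α - ρ α)) := by
    rw [hlamρ, hμρv, map_div₀, hμv, hylev₁, two_mul, pow_add, mul_div_cancel_right₀ _ (pow_ne_zero _ hvjϖ0), hccv, ← pow_add, ← pow_add]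
    exact pow_le_pow_right_of_le_one' hjϖle (by omega)
  -- ★ p864194
  obtain ⟨hL0, hL1, hlab⟩ := level_and_label_of_terminalVertex hD hd0 H₂ hW jE hjv hjiso hjfix hρρ hvρ hα hα1 hΘΘ hΘρ hvΘ hΘj φ hφs hφi hφγ hh hΘh hform htube hpr hintL
    hLB.symm hg₀ hg₀1 hprg u hc hc1 hcc hx₁ hBΛ hΛx₁ hw₀Y hyO₁ hylev₁ g1 g2 g3 hΘlam hvlam hlamj huu hule hu1 hdep₁ hμ1 hanti1 hμY1 (n := 4) (by norm_num)
    hlam4 hu4 hsk hμab hσpw' hpwv' hξ hσV₁ hV₁1 hκ' hR₀ hγ₀ hâ hbh hnx haff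
  -- the sign constant on the populated member, the digit moved to `x₀`
  have hsgn : normSign σ (pairing σ H₂ w₀ w₀ * (ϖ * σ ϖ) ^ b) = normSign σ (-hW) :=
    (weight_ne_zero_iff_normSign_pairing_of_gen (α := α) hD h2v jE hjv hjfix hΘj hρρ hvρ hΘΘ hΘρ hvΘ hΘh hh hb hdb hcc hFgap hhWσ hhW1 hlamj f hf hcell Λ x₁ hG₁ hTr').1 hfne
  have hnear : Valued.v (V₁ - Ve) ≤ Valued.v ϖ ^ 4 := by
    have h := (hI Λ x₀ x₁ hG hG₁).2
    rw [← hV₁f, ← hVe, ← map_sub, hjiso] at h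
    simpa using h
  have hNXiff : (Valued.v (α₁ + γ₁ * V₁) = 1) ↔ (Valued.v (α₁ + γ₁ * Ve) = 1) := v_affine_eq_one_iff_of_near hϖlt hγ₁.le (hnear.trans h42)
  refine ⟨hL0, hL1.trans hNXiff, fun hnxe => ?_⟩
  have hnx1 : (Valued.v (α₁ + γ₁ * V₁) = 1) := hNXiff.2 hnxe
  rw [hlab hnx1, normSign_mul_eq_one_iff_eq hsgn, normSign_affine_eq_of_near hD hσα₁ hσγ₁ hγ₁.le hσV₁ hσVe (n := 4) (by norm_num) hnear hnx1]

end Summit.HodgeConjecture.HodgeConjecture.Cruxes.H413.F0P3cDyRamTerminalCellReads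

end
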